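import Literature.NumberTheory.Automorphic.AnisotropicUnitaryGroupCompact
import Literature.NumberTheory.Automorphic.LocalUnitaryGroupCongr
import Literature.NumberTheory.Automorphic.AdicCompletionCompact
import Literature.NumberTheory.Automorphic.GaloisActionPlaces
import HarnessLib

/-!
# The local group `U(H)(F_v)` of a unitary group at a NON-SPLIT finite place where the hermitian form is ANISOTROPIC is compact
# (completions of number fields; the CM datum `cmDatum L N H`)

Topic `NumberTheory/Automorphic`; namespace `Literature.NumberTheory.Automorphic.UnitaryGroup`.  THEOREMS ONLY (kernel lane): no `def`, no named
fact, no instance, no notation, no `sorry`.  Packaging of ★ `HermitianLattice.compactSpace_unitaryGroupOfForm_of_anisotropic`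
(`AnisotropicUnitaryGroupCompact`: the unitary group of an anisotropic hermitian form over a discretely valued field with compact valuation ring is
compact) for the completions `E_w` of a number field: `𝒪_w` is compact (★ `compactSpace_integer_adicCompletion`), a uniformiser exists (Mathlib
`valuation_exists_uniformizer` read in the completion), and the conjugation `σ_w = galAdicCompletionMap c hw` of a place `w` FIXED by `c` preserves
the valuation (★ `valued_galAdicCompletionMap`).

* `exists_v_eq_exp_neg_one_adicCompletion` — a uniformiser of `E_w`: `∃ ϖ, v ϖ = exp (-1)`.
* `compactSpace_unitaryGroupOfForm_placeForm_of_anisotropic` — `U(σ_w, J_w)(E_w)` is compact when the pairing of `J_w = placeForm J w` is anisotropic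
  over `E_w`.
* **`compactSpace_local_of_anisotropic`** — the tree's local group `U(J)(F_v) = UnitaryGroup.«local» E c N J v` (★ `localNonsplitEquiv`: `≃ₜ*` the
  one-place model at a non-split `v`, `c • w = w`) is a COMPACT SPACE; `compactSpace_adelicGroupData_local_of_anisotropic` — the same for the
  `Local v` carrier of ★ `UnitaryGroup.adelicGroupData F E c N J`.
* **`compactSpace_cmDatum_local_of_anisotropic`** — CM packaging: for `L` CM, `H ∈ M_N(L)`, a finite place `v` of `L⁺` NOT split in `L` (`w ∣ v`,
  `c̄ • w = w`) at which `h_{H,w}(x, x) = 0 ⇒ x = 0` on `L_w^N`, the carrier `(cmDatum L N H).Local v` is compact.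

USE (cell hodgecm-mathlib, programme P5, director s465 ∕ A-p04 (g21)'s finding for the `N = 2` edition): for the hermitian PLANE `diag(dV)` of the
P5 letters and `[L⁺:ℚ]` even there is at least one finite place `v ∈ T` where the plane is anisotropic (★ `RemD5CompanionParity.even_ncard_not_isIsotropic_iff`);
there `U(H)(L⁺_v)` is the COMPACT unitary group in two variables — not the quasi-split `U(1,1)(L⁺_v)` — the «`v ∈ S`» situation of
[Rogawski1990, §14.2 (i)–(iii)]: irreducible representations are finite-dimensional and every locally constant function on the group is a test
function.  HC_CM is proved only modulo the printed citations until rung 0 closes.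

## References
* [PlatonovRapinchuk1994] V. Platonov, A. Rapinchuk, *Algebraic Groups and Number Theory* (1994), §3.1 Thm. 3.1 (compact ⟺ anisotropic over a local
  field), §6.2 (unitary groups).
* [Rogawski1990] J. Rogawski, *Automorphic representations of unitary groups in three variables*, Ann. of Math. Stud. 123 (1990), §14.2 p. 232.
* [WeilBNT1967] A. Weil, *Basic Number Theory* (1967), Ch. II §1–§2.
-/

noncomputable section

open scoped Valued WithZero Matrix MatrixGroups
open NumberField IsDedekindDomain

namespace Literature.NumberTheory.Automorphic

namespace UnitaryGroup

open Literature.NumberTheory.Automorphic.HermitianLattice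

/-- **A uniformiser of the completion `E_w`**: some `ϖ ∈ E_w` has `v ϖ = exp (-1)` (a global uniformiser of `w` read in the completion; Mathlib
`valuation_exists_uniformizer`, `valuedAdicCompletion_eq_valuation'`). [cite: WeilBNT1967, Ch. I §4] -/
theorem exists_v_eq_exp_neg_one_adicCompletion {E : Type} [Field E] [NumberField E] (w : HeightOneSpectrum (𝓞 E)) :
    ∃ ϖ : w.adicCompletion E, Valued.v ϖ = WithZero.exp (-1 : ℤ) := by
  obtain ⟨π, hπ⟩ := IsDedekindDomain.HeightOneSpectrum.valuation_exists_uniformizer E w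
  exact ⟨(π : w.adicCompletion E), by rw [IsDedekindDomain.HeightOneSpectrum.valuedAdicCompletion_eq_valuation', hπ]⟩

/-- **`U(σ_w, J_w)(E_w)` is compact when `J_w` is anisotropic**: at a finite place `w` of `E` fixed by `c`, for ANY `J ∈ M_N(E)` whose pairing
`h(x, y) = (σ_w x)ᵀ J_w y` on `E_w^N` is anisotropic, the one-place unitary group `U(σ_w, J_w)` (`σ_w = galAdicCompletionMap c hw`, `J_w = placeForm J w`)
is a compact space (★ `compactSpace_unitaryGroupOfForm_of_anisotropic` with `𝒪_w` compact, a uniformiser of `E_w`, and `v ∘ σ_w = v`).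
[cite: PlatonovRapinchuk1994, §3.1 Thm. 3.1] -/
theorem compactSpace_unitaryGroupOfForm_placeForm_of_anisotropic {F E : Type} [Field F] [Field E] [NumberField E] [Algebra F E]
    (c : E ≃ₐ[F] E) {N : ℕ} (J : Matrix (Fin N) (Fin N) E) (v : HeightOneSpectrum (𝓞 F)) (w : PlacesOver E v) (hw : c • w.1 = w.1)
    (hanis : ∀ x : Fin N → w.1.adicCompletion E,
      UnitaryGroup.hermForm (galAdicCompletionMap (L := E) c hw) (placeForm J w.1) x x = 0 → x = 0) :
    CompactSpace (unitaryGroupOfForm (galAdicCompletionMap (L := E) c hw) (placeForm J w.1)) := by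
  haveI := compactSpace_integer_adicCompletion E w.1
  obtain ⟨ϖ, hϖ⟩ := exists_v_eq_exp_neg_one_adicCompletion w.1
  exact compactSpace_unitaryGroupOfForm_of_anisotropic hϖ (fun x => valued_galAdicCompletionMap (L := E) c hw x) hanis


variable {F E : Type} [Field F] [NumberField F] [Field E] [NumberField E] [Algebra F E] [Algebra.IsQuadraticExtension F E]
  (c : E ≃ₐ[F] E) {N : ℕ} (J : Matrix (Fin N) (Fin N) E) (v : HeightOneSpectrum (𝓞 F)) (w : PlacesOver E v) (hw : c • w.1 = w.1)


/-- **The local unitary group `U(J)(F_v)` is COMPACT at a non-split place where the form is anisotropic**: for `v` a finite place of `F` with a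
place `w ∣ v` of `E` fixed by `c ≠ 1` (i.e. `v` does not split in `E`) such that the pairing of `J_w` on `E_w^N` is anisotropic, the tree's local group
`UnitaryGroup.«local» E c N J v ≤ GL_N(E ⊗_F F_v)` is a compact space — transported along the one-place model ★ `localNonsplitEquiv :
U(J)(F_v) ≃ₜ* U(σ_w, J_w)(E_w)`. [cite: PlatonovRapinchuk1994, §3.1 Thm. 3.1] [cite: Rogawski1990, §14.2 p. 232] -/
theorem compactSpace_local_of_anisotropic (hc : c ≠ 1)
    (hanis : ∀ x : Fin N → w.1.adicCompletion E,
      UnitaryGroup.hermForm (galAdicCompletionMap (L := E) c hw) (placeForm J w.1) x x = 0 → x = 0) :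
    CompactSpace («local» E c N J v) := by
  haveI := compactSpace_integer_adicCompletion E w.1
  obtain ⟨ϖ, hϖ⟩ := exists_v_eq_exp_neg_one_adicCompletion w.1
  exact compactSpace_of_continuousMulEquiv_unitaryGroupOfForm hϖ (fun x => valued_galAdicCompletionMap (L := E) c hw x) hanis
    (localNonsplitEquiv c J hc w hw)

/-- The same for the `Local v` carrier of the tree's generic unitary datum ★ `UnitaryGroup.adelicGroupData F E c N J` (which IS `«local» E c N J v`).
[cite: PlatonovRapinchuk1994, §3.1 Thm. 3.1] -/
theorem compactSpace_adelicGroupData_local_of_anisotropic (hc : c ≠ 1)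
    (hanis : ∀ x : Fin N → w.1.adicCompletion E,
      UnitaryGroup.hermForm (galAdicCompletionMap (L := E) c hw) (placeForm J w.1) x x = 0 → x = 0) :
    CompactSpace ((adelicGroupData F E c N J).Local v) :=
  compactSpace_local_of_anisotropic c J v w hw hc hanis

/-! ### The CM datum -/

/-- **CM packaging**: for a CM field `L`, `H ∈ M_N(L)`, and a finite place `v` of `L⁺` that does NOT split in `L` — a place `w ∣ v` of `L` fixed by
complex conjugation — at which the hermitian pairing of `H` over `L_w` is ANISOTROPIC, the local group `(cmDatum L N H).Local v = U(H)(L⁺_v)` is a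
COMPACT space.  At such places the inner form `U(H)` is not quasi-split ([Rogawski1990, §14.2]: the set `S`); for `N = 2` and the P5 letters this
happens at the places where the hermitian plane `diag(dV) ⊗ L⁺_v` is anisotropic. [cite: PlatonovRapinchuk1994, §3.1 Thm. 3.1]
[cite: Rogawski1990, §14.2 p. 232] -/
theorem compactSpace_cmDatum_local_of_anisotropic (L : Type) [Field L] [NumberField L] [IsCMField L] (N : ℕ)
    (H : Matrix (Fin N) (Fin N) L) (v : HeightOneSpectrum (𝓞 ↥(maximalRealSubfield L)))
    (w : PlacesOver L v) (hw : IsCMField.complexConj L • w.1 = w.1)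
    (hanis : ∀ x : Fin N → w.1.adicCompletion L,
      UnitaryGroup.hermForm (galAdicCompletionMap (L := L) (IsCMField.complexConj L) hw) (placeForm H w.1) x x = 0 → x = 0) :
    CompactSpace ((cmDatum L N H).Local v) :=
  compactSpace_local_of_anisotropic (IsCMField.complexConj L) H v w hw (IsCMField.complexConj_ne_one L) hanis

end UnitaryGroup

end Literature.NumberTheory.Automorphic

end
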